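import Summits.CriticalPhenomena.SAWScalingLimit.Theses.SAWDefectDecoherence
import Summits.CriticalPhenomena.SAWScalingLimit.Theses.SAWDevelopingMap
import Summits.CriticalPhenomena.SAWScalingLimit.Theses.SAWLatticeVirasoro
import Summits.CriticalPhenomena.SAWScalingLimit.Theorems.SAWDefectDecoherenceObservableToSLERSLELawContinuity
import Summits.CriticalPhenomena.SAWScalingLimit.Theorems.SAWDefectDecoherenceObservableToSLERTwoPieceRestrictionLimit
import Summits.CriticalPhenomena.SAWScalingLimit.Theorems.SAWDefectDecoherenceObservableToSLERModulusOfSimpleLimits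
import Summits.CriticalPhenomena.SAWScalingLimit.Theorems.SAWDevelopingMapObservableToSLETypeLadderAssemblyR
import Summits.CriticalPhenomena.SAWScalingLimit.Theorems.SAWDevelopingMapObservableToSLETypeLadderCarvedReductionAssemblyP
import Summits.CriticalPhenomena.SAWScalingLimit.Theorems.SAWDefectDecoherenceObservableToSLERCoOrientedReductionSolid
import Summits.CriticalPhenomena.SAWScalingLimit.Theorems.SAWDefectDecoherenceObservableToSLERResidueAssemblySolid
import Summits.CriticalPhenomena.SAWScalingLimit.Theorems.SAWDefectDecoherenceObservableToSLERMacroRestrictionLimit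
import Summits.CriticalPhenomena.SAWScalingLimit.Theorems.SAWDevelopingMapObservableToSLETypeLadderTwoPieceAdmIdentification
import HarnessLib

/-!
# Crux `SAWDefectDecoherence.ObservableToSLER` (stmt-CriticalPhenomena-14005), line `bridge-gate-renewal`
(skeleton r13): THE RESIDUE ASSEMBLY WITH THE WEAKENED ANCHOR — the crux from {abundance, MACROSCOPIC source
locality, simplicity of subsequential limits} and the solid squeeze

Landing target:
`Summits/CriticalPhenomena/SAWScalingLimit/Theorems/SAWDefectDecoherenceObservableToSLERResidueAssemblyMacro.lean`
(`--supports stmt-CriticalPhenomena-14005`; registered sub-goal `stub_residueMacro_inputs`).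

`observableToSLER_of_residueMacro` — **the crux CLOSED MODULO ITS r13 RESIDUE**, kernel-checked: as
`Residue.observableToSLER_of_residueSolid` (p137704, r11 form) but with the anchor (5a1) `TwoPieceSourceLocality`
(K-uniform arch tightness, NOT implied by DCS Conjecture 1 on bounded domains) replaced by the strictly weaker
(5a1⁻) MACROSCOPIC SOURCE LOCALITY (registered stub `stub_macroSourceLocality` of r13, verbatim; shared with the
strategist line `macro-anchor-split` of the twin crux stmt-CriticalPhenomena-10472), through the landed
`Macro.stub_macroRestrictionLimit` (p145850).  Hypotheses: (2ʀ) `stub_nestedRenewalFatCoSolidR` verbatim, (5a1⁻)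
`stub_macroSourceLocality` verbatim, (5mₐ) the shared item stmt-CriticalPhenomena-7148 by name, (5a4″)
`stub_carvedReduction_squeezeSolid` verbatim (provable; its inner-approximant half is landed, p144792, the outer
half T-A′ is in flight on the twin crux).  After r13 the abundance input 2ʀ is the ONLY hypothesis not implied, in
substance, by DCS Conjecture 1.
-/

noncomputable section

open scoped BigOperators Topology NNReal ENNReal Classical BoundedContinuousFunction
open Filter Set MeasureTheory Metric
open Literature.Probability.LatticeModels (HexVertex hexGraph hexCenter triZeta Site polyline)
open Literature.Probability.RandomPlanarGeometry
open Literature.Probability.RandomPlanarGeometry.SAW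
open UpperHalfPlane (upperHalfPlaneSet)

namespace Summit.CriticalPhenomena.SAWScalingLimit.Theorems.ObservableToSLER.Residue

open Summit.CriticalPhenomena.SAWScalingLimit.Theses.SAWDefectDecoherence (HexObservableLimitR HexTight ObservableToSLER)
open Summit.CriticalPhenomena.SAWScalingLimit.Theorems.ObservableToSLER.BridgeGate
open Summit.CriticalPhenomena.SAWScalingLimit.Theorems.ObservableToSLER.NestedGate

/-- **Registered sub-goal `stub_residueMacro_inputs`** — the two residue-side reductions this assembly rests on,
as ONE statement: (i) the modulus input of the line from the crux's own hypothesis `HexTight` and the shared item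
stmt-CriticalPhenomena-7148 (`Residue.stub_residueSolid_modulus`, p137704, over `Modulus.stub_hexUniformModulus_of_simpleLimits`
p127640), and (ii) the old anchor implies the weakened one (`Macro.macroSourceLocality_of_twoPieceSourceLocality`, p145850). -/
theorem stub_residueMacro_inputs :
    (HexTight → Summit.CriticalPhenomena.SAWScalingLimit.Theses.SAWLatticeVirasoro.HexSimpleSubseqLimits →
      ∀ (D : DobrushinDomain) (a b : ℝ → HexVertex), IsEmbEndpointApprox hexGraph hexCenter D a b →
        ∀ ε > (0 : ℝ), ∀ η > (0 : ℝ), ∃ θ > (0 : ℝ), ∀ᶠ δ : ℝ in 𝓝[>] 0,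
          hexSAWLaw D.carrier δ (a δ) (b δ) {γ | γ.curve ∉ CurveClass.modulusClass ε θ} ≤
            ENNReal.ofReal η) ∧
    ((∀ (E : DobrushinDomain) (ρ : ℝ) (Λ : ℝ → Finset HexVertex) (m₀ : ℝ → ℤ)
        (a : ℝ → Sym2 HexVertex),
        0 < ρ → E.carrier ∩ ball (E.pt 0) ρ = {z : ℂ | (E.pt 0).im < z.im} ∩ ball (E.pt 0) ρ →
        (∀ᶠ δ : ℝ in 𝓝[>] 0, hexDomainSimplyConnected (Λ δ) ∧ a δ ∈ hexDomainBoundary (Λ δ) ∧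
          (∀ v ∈ Λ δ, (δ : ℂ) * hexCenter v ∈ E.carrier) ∧
          (∀ v : HexVertex, (δ : ℂ) * hexCenter v ∈ ball (E.pt 0) ρ → (v ∈ Λ δ ↔ m₀ δ ≤ v.1 1))) →
        Tendsto (fun δ : ℝ => (δ : ℂ) * hexMidpoint (a δ)) (𝓝[>] 0) (𝓝 (E.pt 0)) →
        ∀ ε : ℝ, 0 < ε → ∃ K : ℝ, 0 < K ∧ ∃ t₀ : ℝ, 0 < t₀ ∧
          ∀ (s : ℝ → Sym2 HexVertex) (t : ℝ), t ≠ 0 → |t| < t₀ →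
            (∀ᶠ δ : ℝ in 𝓝[>] 0, s δ ∈ hexDomainBoundary (Λ δ) ∧
              (hexMidpoint (s δ)).im = (hexMidpoint (a δ)).im) →
            Tendsto (fun δ : ℝ => (δ : ℂ) * hexMidpoint (s δ)) (𝓝[>] 0) (𝓝 (E.pt 0 + t)) →
            ∀ᶠ δ : ℝ in 𝓝[>] 0,
              (∑ γ : HexMidEdgeSAW (Λ δ) (a δ) (s δ),
                  if ∃ v ∈ γ.verts, K * |t| ≤ dist ((δ : ℂ) * hexCenter v) ((δ : ℂ) * hexMidpoint (a δ))
                  then hexCriticalFugacity ^ γ.length else 0) ≤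
                ε * ∑ γ : HexMidEdgeSAW (Λ δ) (a δ) (s δ), hexCriticalFugacity ^ γ.length) →
      ∀ (E : DobrushinDomain) (ρ : ℝ) (Λ : ℝ → Finset HexVertex) (m₀ : ℝ → ℤ)
        (a : ℝ → Sym2 HexVertex),
        0 < ρ → E.carrier ∩ ball (E.pt 0) ρ = {z : ℂ | (E.pt 0).im < z.im} ∩ ball (E.pt 0) ρ →
        (∀ᶠ δ : ℝ in 𝓝[>] 0, hexDomainSimplyConnected (Λ δ) ∧
          (hexGraph.induce (↑(Λ δ) : Set HexVertex)).Preconnected ∧ a δ ∈ hexDomainBoundary (Λ δ) ∧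
          (∀ v ∈ Λ δ, (δ : ℂ) * hexCenter v ∈ E.carrier) ∧
          (∀ v : HexVertex, (δ : ℂ) * hexCenter v ∈ ball (E.pt 0) ρ → (v ∈ Λ δ ↔ m₀ δ ≤ v.1 1))) →
        (∀ K : Set ℂ, IsCompact K → K ⊆ E.carrier →
          ∀ᶠ δ : ℝ in 𝓝[>] 0, ∀ v : HexVertex, (δ : ℂ) * hexCenter v ∈ K → v ∈ Λ δ) →
        Tendsto (fun δ : ℝ => (δ : ℂ) * hexMidpoint (a δ)) (𝓝[>] 0) (𝓝 (E.pt 0)) →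
        ∀ ε : ℝ, 0 < ε → ∀ r : ℝ, 0 < r → ∃ t₀ : ℝ, 0 < t₀ ∧
          ∀ (s : ℝ → Sym2 HexVertex) (t : ℝ), t ≠ 0 → |t| < t₀ →
            (∀ᶠ δ : ℝ in 𝓝[>] 0, s δ ∈ hexDomainBoundary (Λ δ) ∧
              (hexMidpoint (s δ)).im = (hexMidpoint (a δ)).im) →
            Tendsto (fun δ : ℝ => (δ : ℂ) * hexMidpoint (s δ)) (𝓝[>] 0) (𝓝 (E.pt 0 + t)) →
            ∀ᶠ δ : ℝ in 𝓝[>] 0,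
              (∑ γ : HexMidEdgeSAW (Λ δ) (a δ) (s δ),
                  if ∃ v ∈ γ.verts, r ≤ dist ((δ : ℂ) * hexCenter v) ((δ : ℂ) * hexMidpoint (a δ))
                  then hexCriticalFugacity ^ γ.length else 0) ≤
                ε * ∑ γ : HexMidEdgeSAW (Λ δ) (a δ) (s δ), hexCriticalFugacity ^ γ.length) :=
  ⟨stub_residueSolid_modulus,
    Summit.CriticalPhenomena.SAWScalingLimit.Theorems.ObservableToSLER.Macro.macroSourceLocality_of_twoPieceSourceLocality⟩

/-- **THE RESIDUE ASSEMBLY, WEAKENED-ANCHOR FORM (r13).**  `ObservableToSLER` from: (2ʀ) nested renewal with fat co-oriented solid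
tame families, locality scale bounded; (5a1⁻) MACROSCOPIC source locality; (5mₐ) simplicity of all subsequential limits
of the critical hexagonal SAW laws (item stmt-CriticalPhenomena-7148); (5a4″) the solid moving-carving squeeze from the
two-piece admissible restriction limit.  Hypotheses 1, 2, 4 are the registered stubs of skeleton r13 verbatim. -/
theorem observableToSLER_of_residueMacro
    (h2 :
      ∀ (D : DobrushinDomain) (a b : ℝ → HexVertex), IsEmbEndpointApprox hexGraph hexCenter D a b →
        ∀ ε > (0 : ℝ), ∃ R₂ > (0 : ℝ), ∀ R ∈ Set.Ioc (0 : ℝ) R₂, ∃ ρ > (0 : ℝ), ∃ N : ℕ, ∀ᶠ δ : ℝ in 𝓝[>] 0,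
          ∃ S T : ℕ → Set HexVertex,
            TameNestedFamily δ R N (a δ) S ∧ TameNestedFamily δ R N (b δ) T ∧
            ((∀ n, ExteriorAnchored D.carrier δ (S n) (a δ)) ∧
              (∀ n, ExteriorAnchored D.carrier δ (T n) (b δ)) ∧
              ∃ j : Fin 6,
                ((∀ (n : ℕ) (p q : HexVertex), HasCleanWindow D.carrier δ ρ (S n) p q →
                    rowOf j q = rowOf j p + 1 ∧
                      ∀ x : HexVertex, (δ : ℂ) * hexCenter x ∈ ball ((δ : ℂ) * hexCenter q) ρ →
                        (x ∈ S n ↔ rowOf j x ≤ rowOf j p)) ∧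
                  (∀ (n : ℕ) (p q : HexVertex), HasCleanWindow D.carrier δ ρ (T n) p q →
                    rowOf j q = rowOf j p + 1 ∧
                      ∀ x : HexVertex, (δ : ℂ) * hexCenter x ∈ ball ((δ : ℂ) * hexCenter q) ρ →
                        (x ∈ T n ↔ rowOf j x ≤ rowOf j p))) ∧
                (∀ (n : ℕ) (p q : HexVertex), HasCleanWindow D.carrier δ ρ (S n) p q →
                  ∃ K : Set ℂ, IsCompact K ∧ IsConnected K ∧
                    (δ : ℂ) * hexCenter q - ((ρ / 2 : ℝ) : ℂ) * Complex.I * triZeta ^ (j : ℕ) ∈ K ∧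
                    (δ : ℂ) * hexCenter (a δ) ∈ K ∧
                    ∀ v : HexVertex, Metric.infDist ((δ : ℂ) * hexCenter v) K ≤ ρ / 4 → v ∈ S n) ∧
                (∀ (n : ℕ) (p q : HexVertex), HasCleanWindow D.carrier δ ρ (T n) p q →
                  ∃ K : Set ℂ, IsCompact K ∧ IsConnected K ∧
                    (δ : ℂ) * hexCenter q - ((ρ / 2 : ℝ) : ℂ) * Complex.I * triZeta ^ (j : ℕ) ∈ K ∧
                    (δ : ℂ) * hexCenter (b δ) ∈ K ∧
                    ∀ v : HexVertex, Metric.infDist ((δ : ℂ) * hexCenter v) K ≤ ρ / 4 → v ∈ T n) ∧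
                (∀ n : ℕ, ∃ K : Set ℂ, IsCompact K ∧ IsConnected K ∧ (δ : ℂ) * hexCenter (a δ) ∈ K ∧
                  (∀ v : HexVertex, Metric.infDist ((δ : ℂ) * hexCenter v) K ≤ ρ / 8 → v ∈ S n) ∧
                  (∀ v ∈ S n, ∃ (t w : HexVertex) (r : ℕ), v ∈ hexBall t r ∧ w ∈ hexBall t r ∧
                    hexBall t r ⊆ S n ∧ Metric.infDist ((δ : ℂ) * hexCenter w) K ≤ ρ / 16)) ∧
                (∀ n : ℕ, ∃ K : Set ℂ, IsCompact K ∧ IsConnected K ∧ (δ : ℂ) * hexCenter (b δ) ∈ K ∧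
                  (∀ v : HexVertex, Metric.infDist ((δ : ℂ) * hexCenter v) K ≤ ρ / 8 → v ∈ T n) ∧
                  (∀ v ∈ T n, ∃ (t w : HexVertex) (r : ℕ), v ∈ hexBall t r ∧ w ∈ hexBall t r ∧
                    hexBall t r ⊆ T n ∧ Metric.infDist ((δ : ℂ) * hexCenter w) K ≤ ρ / 16))) ∧
            hexSAWLaw D.carrier δ (a δ) (b δ)
                {γ | ¬ ∃ (n m : ℕ) (p q : HexVertex) (n' m' : ℕ) (p' q' : HexVertex),
                    IsFirstGoodGateN D.carrier δ ρ R S (a δ) γ.walk.support n m p q ∧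
                    IsFirstGoodGateN D.carrier δ ρ R T (b δ) γ.walk.support.reverse n' m' p' q' ∧
                    WideLink D.carrier δ ρ (S n ∪ T n') q q'} ≤
              ENNReal.ofReal ε)
    (h5a1 :
      ∀ (E : DobrushinDomain) (ρ : ℝ) (Λ : ℝ → Finset HexVertex) (m₀ : ℝ → ℤ)
        (a : ℝ → Sym2 HexVertex),
        0 < ρ → E.carrier ∩ ball (E.pt 0) ρ = {z : ℂ | (E.pt 0).im < z.im} ∩ ball (E.pt 0) ρ →
        (∀ᶠ δ : ℝ in 𝓝[>] 0, hexDomainSimplyConnected (Λ δ) ∧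
          (hexGraph.induce (↑(Λ δ) : Set HexVertex)).Preconnected ∧ a δ ∈ hexDomainBoundary (Λ δ) ∧
          (∀ v ∈ Λ δ, (δ : ℂ) * hexCenter v ∈ E.carrier) ∧
          (∀ v : HexVertex, (δ : ℂ) * hexCenter v ∈ ball (E.pt 0) ρ → (v ∈ Λ δ ↔ m₀ δ ≤ v.1 1))) →
        (∀ K : Set ℂ, IsCompact K → K ⊆ E.carrier →
          ∀ᶠ δ : ℝ in 𝓝[>] 0, ∀ v : HexVertex, (δ : ℂ) * hexCenter v ∈ K → v ∈ Λ δ) →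
        Tendsto (fun δ : ℝ => (δ : ℂ) * hexMidpoint (a δ)) (𝓝[>] 0) (𝓝 (E.pt 0)) →
        ∀ ε : ℝ, 0 < ε → ∀ r : ℝ, 0 < r → ∃ t₀ : ℝ, 0 < t₀ ∧
          ∀ (s : ℝ → Sym2 HexVertex) (t : ℝ), t ≠ 0 → |t| < t₀ →
            (∀ᶠ δ : ℝ in 𝓝[>] 0, s δ ∈ hexDomainBoundary (Λ δ) ∧
              (hexMidpoint (s δ)).im = (hexMidpoint (a δ)).im) →
            Tendsto (fun δ : ℝ => (δ : ℂ) * hexMidpoint (s δ)) (𝓝[>] 0) (𝓝 (E.pt 0 + t)) →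
            ∀ᶠ δ : ℝ in 𝓝[>] 0,
              (∑ γ : HexMidEdgeSAW (Λ δ) (a δ) (s δ),
                  if ∃ v ∈ γ.verts, r ≤ dist ((δ : ℂ) * hexCenter v) ((δ : ℂ) * hexMidpoint (a δ))
                  then hexCriticalFugacity ^ γ.length else 0) ≤
                ε * ∑ γ : HexMidEdgeSAW (Λ δ) (a δ) (s δ), hexCriticalFugacity ^ γ.length)
    (h7148 : Summit.CriticalPhenomena.SAWScalingLimit.Theses.SAWLatticeVirasoro.HexSimpleSubseqLimits)
    (hSq :
      (∀ (D D' : DobrushinDomain) (ρ : ℝ) (φ : ConformalEquiv upperHalfPlaneSet D.carrier)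
        (Φ : ConformalEquiv (upperHalfPlaneSet \ φ.pullbackHull D') upperHalfPlaneSet) (d : ℝ)
        (Λ Λ' : ℝ → Finset HexVertex) (m₀ m₁ m₁' : ℝ → ℤ) (a b : ℝ → Sym2 HexVertex),
        (0 < ρ ∧ ∀ i : Fin 2, D.carrier ∩ ball (D.pt i) ρ = {z : ℂ | (D.pt i).im < z.im} ∩ ball (D.pt i) ρ) →
        D.IsHullSubdomain D' → D.IsChordalUniformizing φ →
        IsRestrictionMap (φ.pullbackHull D') Φ → HasRestrictionDeriv (φ.pullbackHull D') Φ d →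
        (∀ᶠ δ : ℝ in 𝓝[>] 0,
          Λ' δ ⊆ Λ δ ∧ hexDomainSimplyConnected (Λ δ) ∧ hexDomainSimplyConnected (Λ' δ) ∧
          (hexGraph.induce (↑(Λ δ) : Set HexVertex)).Preconnected ∧
          (hexGraph.induce (↑(Λ' δ) : Set HexVertex)).Preconnected ∧
          a δ ∈ hexDomainBoundary (Λ δ) ∧ b δ ∈ hexDomainBoundary (Λ δ) ∧
          a δ ∈ hexDomainBoundary (Λ' δ) ∧ b δ ∈ hexDomainBoundary (Λ' δ) ∧
          Nonempty (HexMidEdgeSAW (Λ' δ) (a δ) (b δ)) ∧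
          (∀ v ∈ Λ δ, (δ : ℂ) * hexCenter v ∈ D.carrier) ∧
          (∀ v ∈ Λ' δ, (δ : ℂ) * hexCenter v ∈ D'.carrier) ∧
          (∀ v : HexVertex, (δ : ℂ) * hexCenter v ∈ ball (D.pt 0) ρ →
            ((v ∈ Λ δ ↔ m₀ δ ≤ v.1 1) ∧ (v ∈ Λ' δ ↔ m₀ δ ≤ v.1 1))) ∧
          (∀ v : HexVertex, (δ : ℂ) * hexCenter v ∈ ball (D.pt 1) ρ →
            ((v ∈ Λ δ ↔ m₁ δ ≤ v.1 1) ∧ (v ∈ Λ' δ ↔ m₁' δ ≤ v.1 1)))) →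
        (∀ K : Set ℂ, IsCompact K → K ⊆ D.carrier →
          ∀ᶠ δ : ℝ in 𝓝[>] 0, ∀ v : HexVertex, (δ : ℂ) * hexCenter v ∈ K → v ∈ Λ δ) →
        (∀ K : Set ℂ, IsCompact K → K ⊆ D'.carrier →
          ∀ᶠ δ : ℝ in 𝓝[>] 0, ∀ v : HexVertex, (δ : ℂ) * hexCenter v ∈ K → v ∈ Λ' δ) →
        Tendsto (fun δ : ℝ => (δ : ℂ) * hexMidpoint (a δ)) (𝓝[>] 0) (𝓝 (D.pt 0)) →
        Tendsto (fun δ : ℝ => (δ : ℂ) * hexMidpoint (b δ)) (𝓝[>] 0) (𝓝 (D.pt 1)) →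
        Tendsto (fun δ : ℝ =>
            (∑ γ : HexMidEdgeSAW (Λ' δ) (a δ) (b δ), hexCriticalFugacity ^ γ.length) /
              (∑ γ : HexMidEdgeSAW (Λ δ) (a δ) (b δ), hexCriticalFugacity ^ γ.length)) (𝓝[>] 0)
          (𝓝 (d ^ ((5 : ℝ) / 8)))) →
      (∀ (D : DobrushinDomain) (a b : ℝ → HexVertex), IsEmbEndpointApprox hexGraph hexCenter D a b →
        ∀ η > (0 : ℝ), ∃ R₀ > (0 : ℝ), ∀ R ∈ Set.Ioc (0 : ℝ) R₀, ∀ ρ > (0 : ℝ), ∀ N : ℕ,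
            ∀ (δ : ℕ → ℝ) (S T : ℕ → ℕ → Set HexVertex) (n n' : ℕ → ℕ) (q q' : ℕ → HexVertex),
              Tendsto δ atTop (𝓝[>] 0) →
              (∀ k, TameNestedFamily (δ k) R N (a (δ k)) (S k) ∧
                TameNestedFamily (δ k) R N (b (δ k)) (T k) ∧
                (((∀ i, ExteriorAnchored D.carrier (δ k) (S k i) (a (δ k))) ∧
            (∀ i, ExteriorAnchored D.carrier (δ k) (T k i) (b (δ k))) ∧
            (∀ (i : ℕ) (p q : HexVertex), HasCleanWindow D.carrier (δ k) ρ (S k i) p q →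
              rowOf 0 q = rowOf 0 p + 1 ∧
                ∀ x : HexVertex, ((δ k : ℝ) : ℂ) * hexCenter x ∈ ball (((δ k : ℝ) : ℂ) * hexCenter q) ρ →
                  (x ∈ S k i ↔ rowOf 0 x ≤ rowOf 0 p)) ∧
            (∀ (i : ℕ) (p q : HexVertex), HasCleanWindow D.carrier (δ k) ρ (T k i) p q →
              rowOf 0 q = rowOf 0 p + 1 ∧
                ∀ x : HexVertex, ((δ k : ℝ) : ℂ) * hexCenter x ∈ ball (((δ k : ℝ) : ℂ) * hexCenter q) ρ →
                  (x ∈ T k i ↔ rowOf 0 x ≤ rowOf 0 p))) ∧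
            (∀ (i : ℕ) (p q : HexVertex), HasCleanWindow D.carrier (δ k) ρ (S k i) p q →
              ∃ K : Set ℂ, IsCompact K ∧ IsConnected K ∧
                ((δ k : ℝ) : ℂ) * hexCenter q - ((ρ / 2 : ℝ) : ℂ) * Complex.I ∈ K ∧ ((δ k : ℝ) : ℂ) * hexCenter (a (δ k)) ∈ K ∧
                ∀ v : HexVertex, Metric.infDist (((δ k : ℝ) : ℂ) * hexCenter v) K ≤ ρ / 4 → v ∈ S k i) ∧
            (∀ (i : ℕ) (p q : HexVertex), HasCleanWindow D.carrier (δ k) ρ (T k i) p q →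
              ∃ K : Set ℂ, IsCompact K ∧ IsConnected K ∧
                ((δ k : ℝ) : ℂ) * hexCenter q - ((ρ / 2 : ℝ) : ℂ) * Complex.I ∈ K ∧ ((δ k : ℝ) : ℂ) * hexCenter (b (δ k)) ∈ K ∧
                ∀ v : HexVertex, Metric.infDist (((δ k : ℝ) : ℂ) * hexCenter v) K ≤ ρ / 4 → v ∈ T k i) ∧
            (∀ i : ℕ, ∃ K : Set ℂ, IsCompact K ∧ IsConnected K ∧ ((δ k : ℝ) : ℂ) * hexCenter (a (δ k)) ∈ K ∧
              (∀ v : HexVertex, Metric.infDist (((δ k : ℝ) : ℂ) * hexCenter v) K ≤ ρ / 8 → v ∈ S k i) ∧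
              (∀ v ∈ S k i, ∃ (t w : HexVertex) (r : ℕ), v ∈ hexBall t r ∧ w ∈ hexBall t r ∧
                hexBall t r ⊆ S k i ∧ Metric.infDist (((δ k : ℝ) : ℂ) * hexCenter w) K ≤ ρ / 16)) ∧
            (∀ i : ℕ, ∃ K : Set ℂ, IsCompact K ∧ IsConnected K ∧ ((δ k : ℝ) : ℂ) * hexCenter (b (δ k)) ∈ K ∧
              (∀ v : HexVertex, Metric.infDist (((δ k : ℝ) : ℂ) * hexCenter v) K ≤ ρ / 8 → v ∈ T k i) ∧
              (∀ v ∈ T k i, ∃ (t w : HexVertex) (r : ℕ), v ∈ hexBall t r ∧ w ∈ hexBall t r ∧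
                hexBall t r ⊆ T k i ∧ Metric.infDist (((δ k : ℝ) : ℂ) * hexCenter w) K ≤ ρ / 16)))) →
              (∀ k, ∃ (γ : HexDomainSAW D.carrier (δ k) (a (δ k)) (b (δ k))) (m : ℕ) (p : HexVertex)
                  (m' : ℕ) (p' : HexVertex),
                IsFirstGoodGateN D.carrier (δ k) ρ R (S k) (a (δ k)) γ.walk.support (n k) m p (q k) ∧
                IsFirstGoodGateN D.carrier (δ k) ρ R (T k) (b (δ k)) γ.walk.support.reverse
                  (n' k) m' p' (q' k) ∧
                WideLink D.carrier (δ k) ρ (S k (n k) ∪ T k (n' k)) (q k) (q' k)) →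
              ∀ ε' > (0 : ℝ), ∀ φ : ℕ → ℕ, StrictMono φ →
                ∃ (ψ : ℕ → ℕ) (M : DobrushinDomain) (τ : ℂ) (ρ' : ℝ) (Λ' : ℝ → Finset HexVertex)
                  (m : Fin 2 → ℝ → ℤ) (a' b' : ℝ → Sym2 HexVertex) (x : ℕ → Site 2)
                  (Λ'' : ℕ → Finset HexVertex) (pu pv : ℕ → HexVertex),
                  StrictMono ψ ∧
                  (∀ t : ℝ, dist (M.boundary t + τ) (D.boundary t) ≤ η) ∧
                  dist (M.pt 0 + τ) (D.pt 0) ≤ η ∧ dist (M.pt 1 + τ) (D.pt 1) ≤ η ∧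
                  (0 < ρ' ∧ ∀ i : Fin 2,
                    M.carrier ∩ ball (M.pt i) ρ' = {z : ℂ | (M.pt i).im < z.im} ∩ ball (M.pt i) ρ') ∧
                  (∀ᶠ δ' : ℝ in 𝓝[>] 0, hexDomainSimplyConnected (Λ' δ') ∧
                    a' δ' ∈ hexDomainBoundary (Λ' δ') ∧ b' δ' ∈ hexDomainBoundary (Λ' δ') ∧
                    Nonempty (HexMidEdgeSAW (Λ' δ') (a' δ') (b' δ')) ∧
                    (hexGraph.induce (↑(Λ' δ') : Set HexVertex)).Preconnected ∧
                    (∀ v ∈ Λ' δ', (δ' : ℂ) * hexCenter v ∈ M.carrier) ∧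
                    (∀ i : Fin 2, ∀ v : HexVertex, (δ' : ℂ) * hexCenter v ∈ ball (M.pt i) ρ' →
                      (v ∈ Λ' δ' ↔ m i δ' ≤ v.1 1))) ∧
                  (∀ K : Set ℂ, IsCompact K → K ⊆ M.carrier →
                    ∀ᶠ δ' : ℝ in 𝓝[>] 0, ∀ v : HexVertex, (δ' : ℂ) * hexCenter v ∈ K → v ∈ Λ' δ') ∧
                  Tendsto (fun δ' : ℝ => (δ' : ℂ) * hexMidpoint (a' δ')) (𝓝[>] 0) (𝓝 (M.pt 0)) ∧
                  Tendsto (fun δ' : ℝ => (δ' : ℂ) * hexMidpoint (b' δ')) (𝓝[>] 0) (𝓝 (M.pt 1)) ∧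
                  Tendsto (fun j : ℕ => ((δ (φ (ψ j)) : ℝ) : ℂ) *
                    Literature.Probability.LatticeModels.triEmbed (x j)) atTop (𝓝 τ) ∧
                  (∀ j : ℕ,
                    (∀ w : HexVertex, w ∈ Λ'' j ↔ ((-(x j) + w.1, w.2) : HexVertex) ∈ Λ' (δ (φ (ψ j)))) ∧
                    (∀ w ∈ Λ'' j, w ∉ S (φ (ψ j)) (n (φ (ψ j))) ∪ T (φ (ψ j)) (n' (φ (ψ j)))) ∧
                    (∀ w ∈ Λ'' j, ∀ y ∈ Λ'' j, hexGraph.Adj w y →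
                      (hexDomainGraph D.carrier (δ (φ (ψ j)))).Adj w y) ∧
                    q (φ (ψ j)) ∈ Λ'' j ∧
                    pu j ∈ S (φ (ψ j)) (n (φ (ψ j))) ∪ T (φ (ψ j)) (n' (φ (ψ j))) ∧
                    pv j ∈ S (φ (ψ j)) (n (φ (ψ j))) ∪ T (φ (ψ j)) (n' (φ (ψ j))) ∧
                    hexGraph.Adj (q (φ (ψ j))) (pu j) ∧
                    s(q (φ (ψ j)), pu j) ≠ s(q' (φ (ψ j)), pv j) ∧
                    (a' (δ (φ (ψ j)))).map (fun w : HexVertex => ((x j + w.1, w.2) : HexVertex)) =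
                      s(q (φ (ψ j)), pu j) ∧
                    (b' (δ (φ (ψ j)))).map (fun w : HexVertex => ((x j + w.1, w.2) : HexVertex)) =
                      s(q' (φ (ψ j)), pv j)) ∧
                  (∀ᶠ j : ℕ in atTop, 1 - ε' ≤
                    (carvedLaw D.carrier (δ (φ (ψ j))) (S (φ (ψ j)) (n (φ (ψ j))) ∪ T (φ (ψ j)) (n' (φ (ψ j))))
                      (q (φ (ψ j))) (q' (φ (ψ j))) {ξ | ∀ w ∈ ξ.walk.support, w ∈ Λ'' j}).toReal))) :
    ObservableToSLER := by
  intro hO hT D₀ a₀ b₀ hab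
  -- the family constraint of r11 (fat co-oriented solid), as a term
  let P : DobrushinDomain → (ℝ → HexVertex) → (ℝ → HexVertex) → ℝ → ℝ → ℝ → ℕ →
      (ℕ → Set HexVertex) → (ℕ → Set HexVertex) → Prop :=
    fun D a b δ ρ _R _N S T =>
      (∀ n, ExteriorAnchored D.carrier δ (S n) (a δ)) ∧
        (∀ n, ExteriorAnchored D.carrier δ (T n) (b δ)) ∧
        ∃ j : Fin 6,
          ((∀ (n : ℕ) (p q : HexVertex), HasCleanWindow D.carrier δ ρ (S n) p q →
              rowOf j q = rowOf j p + 1 ∧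
                ∀ x : HexVertex, (δ : ℂ) * hexCenter x ∈ ball ((δ : ℂ) * hexCenter q) ρ →
                  (x ∈ S n ↔ rowOf j x ≤ rowOf j p)) ∧
            (∀ (n : ℕ) (p q : HexVertex), HasCleanWindow D.carrier δ ρ (T n) p q →
              rowOf j q = rowOf j p + 1 ∧
                ∀ x : HexVertex, (δ : ℂ) * hexCenter x ∈ ball ((δ : ℂ) * hexCenter q) ρ →
                  (x ∈ T n ↔ rowOf j x ≤ rowOf j p))) ∧
          (∀ (n : ℕ) (p q : HexVertex), HasCleanWindow D.carrier δ ρ (S n) p q →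
            ∃ K : Set ℂ, IsCompact K ∧ IsConnected K ∧
              (δ : ℂ) * hexCenter q - ((ρ / 2 : ℝ) : ℂ) * Complex.I * triZeta ^ (j : ℕ) ∈ K ∧
              (δ : ℂ) * hexCenter (a δ) ∈ K ∧
              ∀ v : HexVertex, Metric.infDist ((δ : ℂ) * hexCenter v) K ≤ ρ / 4 → v ∈ S n) ∧
          (∀ (n : ℕ) (p q : HexVertex), HasCleanWindow D.carrier δ ρ (T n) p q →
            ∃ K : Set ℂ, IsCompact K ∧ IsConnected K ∧
              (δ : ℂ) * hexCenter q - ((ρ / 2 : ℝ) : ℂ) * Complex.I * triZeta ^ (j : ℕ) ∈ K ∧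
              (δ : ℂ) * hexCenter (b δ) ∈ K ∧
              ∀ v : HexVertex, Metric.infDist ((δ : ℂ) * hexCenter v) K ≤ ρ / 4 → v ∈ T n) ∧
          (∀ i : ℕ, ∃ K : Set ℂ, IsCompact K ∧ IsConnected K ∧ (δ : ℂ) * hexCenter (a δ) ∈ K ∧
            (∀ v : HexVertex, Metric.infDist ((δ : ℂ) * hexCenter v) K ≤ ρ / 8 → v ∈ S i) ∧
            (∀ v ∈ S i, ∃ (t w : HexVertex) (r : ℕ), v ∈ hexBall t r ∧ w ∈ hexBall t r ∧
              hexBall t r ⊆ S i ∧ Metric.infDist ((δ : ℂ) * hexCenter w) K ≤ ρ / 16)) ∧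
          (∀ i : ℕ, ∃ K : Set ℂ, IsCompact K ∧ IsConnected K ∧ (δ : ℂ) * hexCenter (b δ) ∈ K ∧
            (∀ v : HexVertex, Metric.infDist ((δ : ℂ) * hexCenter v) K ≤ ρ / 8 → v ∈ T i) ∧
            (∀ v ∈ T i, ∃ (t w : HexVertex) (r : ℕ), v ∈ hexBall t r ∧ w ∈ hexBall t r ∧
              hexBall t r ⊆ T i ∧ Metric.infDist ((δ : ℂ) * hexCenter w) K ≤ ρ / 16))
  -- the class-zero solid family constraint (source class of the co-oriented reduction), as a term
  let P₀ : DobrushinDomain → (ℝ → HexVertex) → (ℝ → HexVertex) → ℝ → ℝ → ℝ → ℕ →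
      (ℕ → Set HexVertex) → (ℕ → Set HexVertex) → Prop :=
    fun D a b δ ρ _R _N S T =>
      ((∀ n, ExteriorAnchored D.carrier δ (S n) (a δ)) ∧
        (∀ n, ExteriorAnchored D.carrier δ (T n) (b δ)) ∧
        (∀ (n : ℕ) (p q : HexVertex), HasCleanWindow D.carrier δ ρ (S n) p q →
          rowOf 0 q = rowOf 0 p + 1 ∧
            ∀ x : HexVertex, (δ : ℂ) * hexCenter x ∈ ball ((δ : ℂ) * hexCenter q) ρ →
              (x ∈ S n ↔ rowOf 0 x ≤ rowOf 0 p)) ∧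
        (∀ (n : ℕ) (p q : HexVertex), HasCleanWindow D.carrier δ ρ (T n) p q →
          rowOf 0 q = rowOf 0 p + 1 ∧
            ∀ x : HexVertex, (δ : ℂ) * hexCenter x ∈ ball ((δ : ℂ) * hexCenter q) ρ →
              (x ∈ T n ↔ rowOf 0 x ≤ rowOf 0 p))) ∧
      (∀ (n : ℕ) (p q : HexVertex), HasCleanWindow D.carrier δ ρ (S n) p q →
        ∃ K : Set ℂ, IsCompact K ∧ IsConnected K ∧
          (δ : ℂ) * hexCenter q - ((ρ / 2 : ℝ) : ℂ) * Complex.I ∈ K ∧ (δ : ℂ) * hexCenter (a δ) ∈ K ∧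
          ∀ v : HexVertex, Metric.infDist ((δ : ℂ) * hexCenter v) K ≤ ρ / 4 → v ∈ S n) ∧
      (∀ (n : ℕ) (p q : HexVertex), HasCleanWindow D.carrier δ ρ (T n) p q →
        ∃ K : Set ℂ, IsCompact K ∧ IsConnected K ∧
          (δ : ℂ) * hexCenter q - ((ρ / 2 : ℝ) : ℂ) * Complex.I ∈ K ∧ (δ : ℂ) * hexCenter (b δ) ∈ K ∧
          ∀ v : HexVertex, Metric.infDist ((δ : ℂ) * hexCenter v) K ≤ ρ / 4 → v ∈ T n) ∧
      (∀ i : ℕ, ∃ K : Set ℂ, IsCompact K ∧ IsConnected K ∧ (δ : ℂ) * hexCenter (a δ) ∈ K ∧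
        (∀ v : HexVertex, Metric.infDist ((δ : ℂ) * hexCenter v) K ≤ ρ / 8 → v ∈ S i) ∧
        (∀ v ∈ S i, ∃ (t w : HexVertex) (r : ℕ), v ∈ hexBall t r ∧ w ∈ hexBall t r ∧
          hexBall t r ⊆ S i ∧ Metric.infDist ((δ : ℂ) * hexCenter w) K ≤ ρ / 16)) ∧
      (∀ i : ℕ, ∃ K : Set ℂ, IsCompact K ∧ IsConnected K ∧ (δ : ℂ) * hexCenter (b δ) ∈ K ∧
        (∀ v : HexVertex, Metric.infDist ((δ : ℂ) * hexCenter v) K ≤ ρ / 8 → v ∈ T i) ∧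
        (∀ v ∈ T i, ∃ (t w : HexVertex) (r : ℕ), v ∈ hexBall t r ∧ w ∈ hexBall t r ∧
          hexBall t r ⊆ T i ∧ Metric.infDist ((δ : ℂ) * hexCenter w) K ≤ ρ / 16))
  -- ARL″ from `R` and the anchor (p121515)
  have hARL :=
    Summit.CriticalPhenomena.SAWScalingLimit.Theorems.ObservableToSLER.Macro.stub_macroRestrictionLimit hO h5a1
  -- class-(0,0) solid CSI: squeeze (hypothesis) + T2a (p126992) + generic assembly (p130700) + Radó continuity (p81676)
  have hCSI₀ :=
    Summit.CriticalPhenomena.SAWScalingLimit.Theorems.ObservableToSLE.TypeLadder.stub_carvedReduction_assemblyP P₀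
      (hSq hARL)
      (Summit.CriticalPhenomena.SAWScalingLimit.Theorems.ObservableToSLE.TypeLadder.stub_twoPieceAdmIdentification hARL)
      stub_sleLawContinuity
  -- co-oriented solid CSI (p134331)
  have hCSI :=
    Summit.CriticalPhenomena.SAWScalingLimit.Theorems.ObservableToSLER.CoOrientedSolid.stub_coOrientedReductionSolid hCSI₀
  -- modulus (p127640) and the sequential reduction (p120538) with averaged tightness (p116996) / modulus (p120791)
  have hMod := stub_residueSolid_modulus hT h7148
  have hCarved := stub_seqReductionPM P hCSI (stub_midTightN hT) (stub_midModulusN hMod)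
  -- the R-bounded nested transfer (p124665) and the identification criterion
  have hfull :=
    Summit.CriticalPhenomena.SAWScalingLimit.Theorems.ObservableToSLE.TypeLadder.stub_nestedTransferPR P
      stub_gateDecomposition h2 hCarved
  exact Summit.CriticalPhenomena.SAWScalingLimit.Theorems.ObservableToSLE.Negative.convergesInLawToSLE_of_identification
    hab (hT D₀ a₀ b₀ hab) (hfull D₀ a₀ b₀ hab)

end Summit.CriticalPhenomena.SAWScalingLimit.Theorems.ObservableToSLER.Residue

end
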